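import Mathlib.RepresentationTheory.Homological.GroupCohomology.LowDegree
import Literature.AlgebraicGeometry.HodgeTheory.LocallyTrivialExtensionClasses
import Summits.HodgeConjecture.HodgeConjecture.Theorems.LinearSystemTorelliLocalTubeSpanDirectSum

/-!
# Route LinearSystemTorelli — crux `LocalTubeSpan` (stmt-HodgeConjecture-2490): a central element acting as `-1` kills `H¹`

Helper file (`--supports stmt-HodgeConjecture-2490`, line `Sketch` of the crux chain, cycle 5,
companion of the stub `stub_centralSplit` / `localTubeSpan_centralSplit`).

The line reduces the crux ("local Schnell theorem", C. Schnell, *Primitive cohomology and the tube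
mapping*, Math. Z. 268 (2010) §3, §7) to CYCLIC DETECTION: injectivity of Schnell's third map
`evalCoinv A : H¹(G, A) → ∏_g A/(g - 1)A`.  For the monodromy group `Γ_Δ` of a COMPLETE skew
vanishing lattice (Schnell's Prop. 12, the global step 3; locally: complete clusters) the line's
proof needs the named fact `Schnell2010_lemma11` (Janssen).  This file records the cheap
unconditional case: if some CENTRAL element `z` of `G` acts as `-1` (over a field of characteristic
`≠ 2`), then EVERY `1`-cocycle is a coboundary — `φ(zg) = φ(gz)` reads `2 φ(g) = -(g - 1) φ(z)`, so
`φ = ∂(-φ(z)/2)` — hence `H¹(G, A) = 0` and the third map is injective with nothing to detect: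

* `localTubeSpan_exists_sub_eq_of_central_neg` — every cocycle is a coboundary;
* `localTubeSpan_injective_evalCoinv_of_central_neg` — cyclic detection holds.

Where it applies: transvection groups containing `-1` on the lattice, e.g. the `A_{2g}` cluster
(`y² = x^{2g+1}`; the Coxeter word `(T₁ ⋯ T_{2g})^{2g+1}` acts as `-1` on the Milnor lattice and
commutes with every `T_δ` since `T_{-δ} = T_δ`), the full `Sp_{2g}(ℤ)`, the monodromy of plane
curves of even degree (Beauville) — Schnell's Prop. 12 for these needs no Janssen input.  It does NOT
apply at the crux's residual members (there the local lattice has a radical carrying the visible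
classes and no central element acts as `-1` on it).  Pure group cohomology over Mathlib; no named
facts, no `sorry`.
-/

-- `Summit.HodgeConjecture.HodgeConjecture.Theorems` is the mandated namespace (single-conjunct summit:
-- Sub = Summit), which `linter.dupNamespace` flags on every declaration; the lakefile turns the
-- linter off tree-wide (weak option), restated here so stand-alone elaboration is warning-free too.
set_option linter.dupNamespace false

noncomputable section

open CategoryTheory groupCohomology
open Literature.AlgebraicGeometry.HodgeTheory

namespace Summit.HodgeConjecture.HodgeConjecture.Theorems

universe u

variable {k G : Type u} [Field k] [Group G] (A : Rep k G)

/-- **A central element acting as `-1` makes every `1`-cocycle a coboundary**: if `z` commutes with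
every element of `G`, acts as `-1` on `A`, and `2 ≠ 0` in `k`, then for every cocycle `φ` there is
`x` (namely `-φ(z)/2`) with `φ(g) = g·x - x` for all `g` (from `φ(z g) = φ(g z)`:
`φ(z) - φ(g) = φ(g) + g·φ(z)`). [folklore] -/
theorem localTubeSpan_exists_sub_eq_of_central_neg (z : G) (hz : ∀ g : G, g * z = z * g)
    (hneg : ∀ x : A.V, A.ρ z x = -x) (h2 : (2 : k) ≠ 0) (φ : cocycles₁ A) :
    ∃ x : A.V, ∀ g : G, A.ρ g x - x = φ g := by
  refine ⟨-((2 : k)⁻¹ • φ z), fun g => ?_⟩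
  have hzg : φ (z * g) = A.ρ z (φ g) + φ z := (mem_cocycles₁_iff φ).1 φ.2 z g
  have hgz : φ (g * z) = A.ρ g (φ z) + φ g := (mem_cocycles₁_iff φ).1 φ.2 g z
  rw [hneg, ← hz g, hgz] at hzg
  -- `hzg : ρ g (φ z) + φ g = -φ g + φ z`, i.e. `2 φ g = φ z - ρ g (φ z)`
  have h2φ : (2 : k) • φ g = φ z - A.ρ g (φ z) := by
    rw [two_smul]
    calc φ g + φ g = (A.ρ g (φ z) + φ g) + φ g - A.ρ g (φ z) := by abel
      _ = (-φ g + φ z) + φ g - A.ρ g (φ z) := by rw [hzg]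
      _ = φ z - A.ρ g (φ z) := by abel
  have hφ : (φ : G → A.V) g = (2 : k)⁻¹ • (φ z - A.ρ g (φ z)) := by
    rw [← h2φ, smul_smul, inv_mul_cancel₀ h2, one_smul]
  rw [hφ, map_neg, map_smul, smul_sub]
  abel

/-- **Cyclic detection when a central element acts as `-1`**: Schnell's third map
`H¹(G, A) → ∏_g A/(g - 1)A` is injective (indeed `H¹(G, A) = 0`), with no arithmetic input — the
case `-1 ∈ ρ(G)` of Schnell's Prop. 12 (e.g. `A_{2g}` clusters via the Coxeter word, `Sp_{2g}(ℤ)`,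
plane curves of even degree). [folklore] -/
theorem localTubeSpan_injective_evalCoinv_of_central_neg (z : G) (hz : ∀ g : G, g * z = z * g)
    (hneg : ∀ x : A.V, A.ρ z x = -x) (h2 : (2 : k) ≠ 0) :
    Function.Injective (evalCoinv A) :=
  (localTubeSpan_injective_evalCoinv_iff_forall_cocycles₁ A).2 fun φ _ =>
    localTubeSpan_exists_sub_eq_of_central_neg A z hz hneg h2 φ

end Summit.HodgeConjecture.HodgeConjecture.Theorems

end
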